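import Literature.Probability.Percolation.PlanarDuality
import Literature.Probability.LatticeModels.ThermodynamicLimit
import HarnessLib

/-!
# Zhang's crossing obstruction: interleaved boundary-to-boundary paths of a box meet

Topic `Probability/LatticeModels` (planar lattice combinatorics of `ℤ²`); theorems only (plus a
walk constructor). The deterministic planar fact behind Step 2 of the proof of the butterfly lemma
of Georgii–Higuchi 2000 (Lemma 3.1, p. 8: on `A⁺₁ ∩ A⁻₂ ∩ A⁺₃ ∩ A⁻₄` "the infinite clusters `I⁺` and
`I⁻` cannot be both unique" — Zhang's argument, cf. [7] = Georgii–Häggström–Maes, Thm. 5.18): in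
the square `Λ_N = [-N, N]²`, let `∂_kΛ_N` be the part of its boundary in the `k`-th closed quadrant.
**If a lattice path inside `Λ_N` joins `∂₁Λ_N` to `∂₃Λ_N` and another lattice path inside `Λ_N`
joins `∂₂Λ_N` to `∂₄Λ_N`, the two paths have a common vertex**
(`exists_mem_support_of_quadrant_crossing`). In the application the first path consists of `+`
spins and the second of `-` spins, which is absurd.

Proof: extend the four endpoints outside `Λ_N` by explicit straight/`L`-shaped runs inside
`Λ_{N+1}` so that the first path becomes a left–right crossing of `Λ_{N+1}` and the second a
bottom–top crossing; by the tree's discrete Jordan-curve lemma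
`exists_mem_support_of_crossing` (`PlanarDuality.lean`: a left–right and a top–bottom crossing of
a rectangle meet) they share a vertex, and a case analysis in coordinates shows that a common
vertex on the added runs forces two of the original endpoints to coincide.

## References

* H.-O. Georgii, Y. Higuchi, J. Math. Phys. 41 (2000), proof of Lemma 3.1, Step 2, pp. 7–8
  [GeorgiiHiguchi2000].
* H. Kesten, *Percolation theory for mathematicians* (1982), §2.2 (crossings of Jordan domains),
  as formalised in `PlanarDuality.lean` [KestenPTM1982].
-/

noncomputable section

open SimpleGraph
open Literature.Probability.Percolation

namespace Literature.Probability.LatticeModels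

namespace Zhang

/-! ### Straight runs -/

/-- The straight walk of `k` steps in the lattice direction `s` from `z`. [folklore] -/
def stepRun (s : Site 2) (hs : ∀ x : Site 2, (zdGraph 2).Adj x (x + s)) (z : Site 2) :
    (k : ℕ) → (zdGraph 2).Walk z ((fun w : Site 2 => w + s)^[k] z)
  | 0 => Walk.nil
  | k + 1 => Walk.cons (hs z) (stepRun s hs (z + s) k)

/-- Coordinates along a straight run. [folklore] -/
theorem iterate_add_apply (s z : Site 2) (k : ℕ) (i : Fin 2) :
    ((fun w : Site 2 => w + s)^[k] z) i = z i + k * s i := by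
  induction k generalizing z with
  | zero => simp
  | succ k ih => rw [Function.iterate_succ_apply, ih]; simp; ring

/-- The vertices of a straight run. [folklore] -/
theorem mem_support_stepRun {s : Site 2} {hs : ∀ x : Site 2, (zdGraph 2).Adj x (x + s)}
    {z w : Site 2} {k : ℕ} :
    w ∈ (stepRun s hs z k).support ↔ ∃ j : ℕ, j ≤ k ∧ w 0 = z 0 + j * s 0 ∧ w 1 = z 1 + j * s 1 := by
  induction k generalizing z with
  | zero =>
    show w ∈ (Walk.nil : (zdGraph 2).Walk z z).support ↔ _
    rw [Walk.support_nil, List.mem_singleton, Site.eq_iff_two]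
    constructor
    · rintro ⟨h0, h1⟩; exact ⟨0, le_rfl, by simp [h0], by simp [h1]⟩
    · rintro ⟨j, hj, h0, h1⟩
      obtain rfl : j = 0 := Nat.le_zero.1 hj
      simp at h0 h1; exact ⟨h0, h1⟩
  | succ k ih =>
    show w ∈ (Walk.cons (hs z) (stepRun s hs (z + s) k)).support ↔ _
    rw [Walk.support_cons, List.mem_cons, ih, Site.eq_iff_two]
    simp only [Pi.add_apply]
    constructor
    · rintro (⟨h0, h1⟩ | ⟨j, hj, h0, h1⟩)
      · exact ⟨0, Nat.zero_le _, by simp [h0], by simp [h1]⟩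
      · refine ⟨j + 1, by omega, ?_, ?_⟩ <;> push_cast <;> linarith
    · rintro ⟨j, hj, h0, h1⟩
      rcases Nat.eq_zero_or_pos j with rfl | hjpos
      · left; simp at h0 h1; exact ⟨h0, h1⟩
      · right
        refine ⟨j - 1, by omega, ?_, ?_⟩
        · rw [Nat.cast_sub hjpos]; push_cast; linarith
        · rw [Nat.cast_sub hjpos]; push_cast; linarith

/-- The four unit steps `z ↦ z ± e₀, z ± e₁` are lattice adjacencies (cf. `adj_add_single_zero`,
`RSWLemma.lean`, and `adj_sub_single_one`, `PlanarDuality.lean`). [folklore] -/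
theorem adj_add_unitStep :
    (∀ x : Site 2, (zdGraph 2).Adj x (x + Pi.single 0 1)) ∧
    (∀ x : Site 2, (zdGraph 2).Adj x (x + -Pi.single 0 1)) ∧
    (∀ x : Site 2, (zdGraph 2).Adj x (x + Pi.single 1 1)) ∧
    (∀ x : Site 2, (zdGraph 2).Adj x (x + -Pi.single 1 1)) :=
  ⟨fun _ => adj_of_stepKind (.right (by simp) (by simp)),
    fun _ => adj_of_stepKind (.left (by simp) (by simp)),
    fun _ => adj_of_stepKind (.up (by simp) (by simp)),
    fun _ => adj_of_stepKind (.down (by simp) (by simp))⟩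

/-! ### The four extensions -/

variable (N : ℕ) (e₁ e₂ e₃ e₄ : Site 2)

/-- Vertices added beyond the endpoint in `∂₁Λ_N` (to reach the right side of `Λ_{N+1}`). [folklore] -/
def Out₁ (z : Site 2) : Prop :=
  (e₁ 0 = N ∧ 0 ≤ e₁ 1 ∧ z 0 = N + 1 ∧ z 1 = e₁ 1) ∨
    (e₁ 1 = N ∧ 0 ≤ e₁ 0 ∧ z 1 = N + 1 ∧ e₁ 0 ≤ z 0 ∧ z 0 ≤ N + 1)

/-- Vertices added beyond the endpoint in `∂₂Λ_N` (to reach the top side of `Λ_{N+1}`). [folklore] -/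
def Out₂ (z : Site 2) : Prop :=
  (e₂ 1 = N ∧ e₂ 0 ≤ 0 ∧ z 1 = N + 1 ∧ z 0 = e₂ 0) ∨
    (e₂ 0 = -N ∧ 0 ≤ e₂ 1 ∧ z 0 = -(N + 1) ∧ e₂ 1 ≤ z 1 ∧ z 1 ≤ N + 1)

/-- Vertices added beyond the endpoint in `∂₃Λ_N` (to reach the left side of `Λ_{N+1}`). [folklore] -/
def Out₃ (z : Site 2) : Prop :=
  (e₃ 0 = -N ∧ e₃ 1 ≤ 0 ∧ z 0 = -(N + 1) ∧ z 1 = e₃ 1) ∨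
    (e₃ 1 = -N ∧ e₃ 0 ≤ 0 ∧ z 1 = -(N + 1) ∧ -(N + 1) ≤ z 0 ∧ z 0 ≤ e₃ 0)

/-- Vertices added beyond the endpoint in `∂₄Λ_N` (to reach the bottom side of `Λ_{N+1}`). [folklore] -/
def Out₄ (z : Site 2) : Prop :=
  (e₄ 1 = -N ∧ 0 ≤ e₄ 0 ∧ z 1 = -(N + 1) ∧ z 0 = e₄ 0) ∨
    (e₄ 0 = N ∧ e₄ 1 ≤ 0 ∧ z 0 = N + 1 ∧ -(N + 1) ≤ z 1 ∧ z 1 ≤ e₄ 1)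

variable {N e₁ e₂ e₃ e₄}

/-- Extension of the endpoint in `∂₁Λ_N` to the right side of `Λ_{N+1}`. [folklore] -/
theorem exists_ext₁ (h₁ : (e₁ 0 = N ∧ 0 ≤ e₁ 1) ∨ (e₁ 1 = N ∧ 0 ≤ e₁ 0 ∧ e₁ 0 ≤ N)) :
    ∃ (r : Site 2) (R : (zdGraph 2).Walk e₁ r), r 0 = N + 1 ∧
      ∀ z ∈ R.support, z = e₁ ∨ Out₁ N e₁ z := by
  rcases h₁ with ⟨h0, h1⟩ | ⟨h1, h0, h0'⟩
  · refine ⟨_, stepRun (Pi.single 0 1) adj_add_unitStep.1 e₁ 1, ?_, fun z hz => ?_⟩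
    · rw [iterate_add_apply]; simp [h0]
    · obtain ⟨j, hj, hz0, hz1⟩ := mem_support_stepRun.1 hz
      simp at hz0 hz1
      rcases Nat.eq_zero_or_pos j with rfl | hj'
      · left; rw [Site.eq_iff_two]; simp at hz0; exact ⟨hz0, hz1⟩
      · right; left
        have : j = 1 := by omega
        subst this
        refine ⟨h0, h1, ?_, hz1⟩; push_cast at hz0; linarith
  · -- up one step, then right to the corner `(N+1, N+1)`
    set k : ℕ := (N + 1 - e₁ 0).toNat with hk
    have hk' : (k : ℤ) = N + 1 - e₁ 0 := by rw [hk, Int.toNat_of_nonneg (by omega)]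
    refine ⟨_, (Walk.cons (adj_add_unitStep.2.2.1 e₁) Walk.nil).append
      (stepRun (Pi.single 0 1) adj_add_unitStep.1 (e₁ + Pi.single 1 1) k), ?_, fun z hz => ?_⟩
    · rw [iterate_add_apply]; simp; rw [hk']; ring
    · rw [Walk.mem_support_append_iff, Walk.support_cons, Walk.support_nil] at hz
      rcases hz with hz | hz
      · simp only [List.mem_cons, List.not_mem_nil, or_false] at hz
        rcases hz with rfl | rfl
        · exact Or.inl rfl
        · right; right
          simp
          refine ⟨h1, h0, by omega, by omega⟩
      · obtain ⟨j, hj, hz0, hz1⟩ := mem_support_stepRun.1 hz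
        simp at hz0 hz1
        right; right
        refine ⟨h1, h0, by omega, by linarith, ?_⟩
        have : (j : ℤ) ≤ k := by exact_mod_cast hj
        linarith

/-- Extension of the endpoint in `∂₂Λ_N` to the top side of `Λ_{N+1}`. [folklore] -/
theorem exists_ext₂ (h₂ : (e₂ 1 = N ∧ e₂ 0 ≤ 0) ∨ (e₂ 0 = -N ∧ 0 ≤ e₂ 1 ∧ e₂ 1 ≤ N)) :
    ∃ (r : Site 2) (R : (zdGraph 2).Walk e₂ r), r 1 = N + 1 ∧
      ∀ z ∈ R.support, z = e₂ ∨ Out₂ N e₂ z := by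
  rcases h₂ with ⟨h1, h0⟩ | ⟨h0, h1, h1'⟩
  · refine ⟨_, stepRun (Pi.single 1 1) adj_add_unitStep.2.2.1 e₂ 1, ?_, fun z hz => ?_⟩
    · rw [iterate_add_apply]; simp [h1]
    · obtain ⟨j, hj, hz0, hz1⟩ := mem_support_stepRun.1 hz
      simp at hz0 hz1
      rcases Nat.eq_zero_or_pos j with rfl | hj'
      · left; rw [Site.eq_iff_two]; simp at hz1; exact ⟨hz0, hz1⟩
      · right; left
        have : j = 1 := by omega
        subst this
        refine ⟨h1, h0, ?_, hz0⟩; push_cast at hz1; linarith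
  · -- left one step, then up to the corner `(-(N+1), N+1)`
    set k : ℕ := (N + 1 - e₂ 1).toNat with hk
    have hk' : (k : ℤ) = N + 1 - e₂ 1 := by rw [hk, Int.toNat_of_nonneg (by omega)]
    refine ⟨_, (Walk.cons (adj_add_unitStep.2.1 e₂) Walk.nil).append
      (stepRun (Pi.single 1 1) adj_add_unitStep.2.2.1 (e₂ + -Pi.single 0 1) k), ?_, fun z hz => ?_⟩
    · rw [iterate_add_apply]; simp; rw [hk']; ring
    · rw [Walk.mem_support_append_iff, Walk.support_cons, Walk.support_nil] at hz
      rcases hz with hz | hz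
      · simp only [List.mem_cons, List.not_mem_nil, or_false] at hz
        rcases hz with rfl | rfl
        · exact Or.inl rfl
        · right; right
          simp
          refine ⟨h0, h1, by omega, by omega⟩
      · obtain ⟨j, hj, hz0, hz1⟩ := mem_support_stepRun.1 hz
        simp at hz0 hz1
        right; right
        refine ⟨h0, h1, by omega, by linarith, ?_⟩
        have : (j : ℤ) ≤ k := by exact_mod_cast hj
        linarith

/-- Extension of the endpoint in `∂₃Λ_N` to the left side of `Λ_{N+1}`. [folklore] -/
theorem exists_ext₃ (h₃ : (e₃ 0 = -N ∧ e₃ 1 ≤ 0) ∨ (e₃ 1 = -N ∧ e₃ 0 ≤ 0 ∧ -N ≤ e₃ 0)) :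
    ∃ (r : Site 2) (R : (zdGraph 2).Walk e₃ r), r 0 = -(N + 1) ∧
      ∀ z ∈ R.support, z = e₃ ∨ Out₃ N e₃ z := by
  rcases h₃ with ⟨h0, h1⟩ | ⟨h1, h0, h0'⟩
  · refine ⟨_, stepRun (-Pi.single 0 1) adj_add_unitStep.2.1 e₃ 1, ?_, fun z hz => ?_⟩
    · rw [iterate_add_apply]; simp [h0]; ring
    · obtain ⟨j, hj, hz0, hz1⟩ := mem_support_stepRun.1 hz
      simp at hz0 hz1
      rcases Nat.eq_zero_or_pos j with rfl | hj'
      · left; rw [Site.eq_iff_two]; simp at hz0; exact ⟨hz0, hz1⟩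
      · right; left
        have : j = 1 := by omega
        subst this
        refine ⟨h0, h1, ?_, hz1⟩; push_cast at hz0; linarith
  · -- down one step, then left to the corner `(-(N+1), -(N+1))`
    set k : ℕ := (N + 1 + e₃ 0).toNat with hk
    have hk' : (k : ℤ) = N + 1 + e₃ 0 := by rw [hk, Int.toNat_of_nonneg (by omega)]
    refine ⟨_, (Walk.cons (adj_add_unitStep.2.2.2 e₃) Walk.nil).append
      (stepRun (-Pi.single 0 1) adj_add_unitStep.2.1 (e₃ + -Pi.single 1 1) k), ?_, fun z hz => ?_⟩
    · rw [iterate_add_apply]; simp; rw [hk']; ring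
    · rw [Walk.mem_support_append_iff, Walk.support_cons, Walk.support_nil] at hz
      rcases hz with hz | hz
      · simp only [List.mem_cons, List.not_mem_nil, or_false] at hz
        rcases hz with rfl | rfl
        · exact Or.inl rfl
        · right; right
          simp
          refine ⟨h1, h0, by omega, by omega⟩
      · obtain ⟨j, hj, hz0, hz1⟩ := mem_support_stepRun.1 hz
        simp at hz0 hz1
        right; right
        refine ⟨h1, h0, by omega, ?_, by linarith⟩
        have : (j : ℤ) ≤ k := by exact_mod_cast hj
        linarith

/-- Extension of the endpoint in `∂₄Λ_N` to the bottom side of `Λ_{N+1}`. [folklore] -/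
theorem exists_ext₄ (h₄ : (e₄ 1 = -N ∧ 0 ≤ e₄ 0) ∨ (e₄ 0 = N ∧ e₄ 1 ≤ 0 ∧ -N ≤ e₄ 1)) :
    ∃ (r : Site 2) (R : (zdGraph 2).Walk e₄ r), r 1 = -(N + 1) ∧
      ∀ z ∈ R.support, z = e₄ ∨ Out₄ N e₄ z := by
  rcases h₄ with ⟨h1, h0⟩ | ⟨h0, h1, h1'⟩
  · refine ⟨_, stepRun (-Pi.single 1 1) adj_add_unitStep.2.2.2 e₄ 1, ?_, fun z hz => ?_⟩
    · rw [iterate_add_apply]; simp [h1]; ring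
    · obtain ⟨j, hj, hz0, hz1⟩ := mem_support_stepRun.1 hz
      simp at hz0 hz1
      rcases Nat.eq_zero_or_pos j with rfl | hj'
      · left; rw [Site.eq_iff_two]; simp at hz1; exact ⟨hz0, hz1⟩
      · right; left
        have : j = 1 := by omega
        subst this
        refine ⟨h1, h0, ?_, hz0⟩; push_cast at hz1; linarith
  · -- right one step, then down to the corner `(N+1, -(N+1))`
    set k : ℕ := (N + 1 + e₄ 1).toNat with hk
    have hk' : (k : ℤ) = N + 1 + e₄ 1 := by rw [hk, Int.toNat_of_nonneg (by omega)]
    refine ⟨_, (Walk.cons (adj_add_unitStep.1 e₄) Walk.nil).append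
      (stepRun (-Pi.single 1 1) adj_add_unitStep.2.2.2 (e₄ + Pi.single 0 1) k), ?_, fun z hz => ?_⟩
    · rw [iterate_add_apply]; simp; rw [hk']; ring
    · rw [Walk.mem_support_append_iff, Walk.support_cons, Walk.support_nil] at hz
      rcases hz with hz | hz
      · simp only [List.mem_cons, List.not_mem_nil, or_false] at hz
        rcases hz with rfl | rfl
        · exact Or.inl rfl
        · right; right
          simp
          refine ⟨h0, h1, by omega, by omega⟩
      · obtain ⟨j, hj, hz0, hz1⟩ := mem_support_stepRun.1 hz
        simp at hz0 hz1
        right; right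
        refine ⟨h0, h1, by omega, ?_, by linarith⟩
        have : (j : ℤ) ≤ k := by exact_mod_cast hj
        linarith

/-- **Coordinate case analysis**: a vertex lying on an odd and on an even extension forces the two
endpoints to coincide. [folklore] -/
theorem eq_of_out_odd_even {z : Site 2}
    (he₁ : ∀ i, -(N : ℤ) ≤ e₁ i ∧ e₁ i ≤ N) (he₂ : ∀ i, -(N : ℤ) ≤ e₂ i ∧ e₂ i ≤ N)
    (he₃ : ∀ i, -(N : ℤ) ≤ e₃ i ∧ e₃ i ≤ N) (he₄ : ∀ i, -(N : ℤ) ≤ e₄ i ∧ e₄ i ≤ N)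
    (hodd : Out₁ N e₁ z ∨ Out₃ N e₃ z) (heven : Out₂ N e₂ z ∨ Out₄ N e₄ z) :
    (e₁ = e₂ ∨ e₁ = e₄) ∨ (e₃ = e₂ ∨ e₃ = e₄) := by
  have h10 := he₁ 0; have h11 := he₁ 1; have h20 := he₂ 0; have h21 := he₂ 1
  have h30 := he₃ 0; have h31 := he₃ 1; have h40 := he₄ 0; have h41 := he₄ 1
  simp only [Site.eq_iff_two]
  simp only [Out₁, Out₂, Out₃, Out₄] at hodd heven
  rcases hodd with (⟨a1, a2, a3, a4⟩ | ⟨a1, a2, a3, a4, a5⟩) | (⟨a1, a2, a3, a4⟩ | ⟨a1, a2, a3, a4, a5⟩) <;>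
    rcases heven with (⟨b1, b2, b3, b4⟩ | ⟨b1, b2, b3, b4, b5⟩) | (⟨b1, b2, b3, b4⟩ | ⟨b1, b2, b3, b4, b5⟩) <;>
    omega

/-- A vertex of `Λ_N` lies on no extension. [folklore] -/
theorem not_out_of_mem_box {z : Site 2} (hz : ∀ i, -(N : ℤ) ≤ z i ∧ z i ≤ N) :
    ¬ (Out₁ N e₁ z ∨ Out₃ N e₃ z) ∧ ¬ (Out₂ N e₂ z ∨ Out₄ N e₄ z) := by
  have hz0 := hz 0; have hz1 := hz 1
  simp only [Out₁, Out₂, Out₃, Out₄]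
  constructor <;> rintro ((⟨a1, a2, a3, a4⟩ | ⟨a1, a2, a3, a4, a5⟩) | (⟨a1, a2, a3, a4⟩ | ⟨a1, a2, a3, a4, a5⟩)) <;>
    omega

/-- Extension vertices stay in `Λ_{N+1}`. [folklore] -/
theorem bounds_of_out {z : Site 2}
    (he₁ : ∀ i, -(N : ℤ) ≤ e₁ i ∧ e₁ i ≤ N) (he₂ : ∀ i, -(N : ℤ) ≤ e₂ i ∧ e₂ i ≤ N)
    (he₃ : ∀ i, -(N : ℤ) ≤ e₃ i ∧ e₃ i ≤ N) (he₄ : ∀ i, -(N : ℤ) ≤ e₄ i ∧ e₄ i ≤ N)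
    (h : (Out₁ N e₁ z ∨ Out₃ N e₃ z) ∨ (Out₂ N e₂ z ∨ Out₄ N e₄ z)) :
    -((N : ℤ) + 1) ≤ z 0 ∧ z 0 ≤ N + 1 ∧ -((N : ℤ) + 1) ≤ z 1 ∧ z 1 ≤ N + 1 := by
  have h10 := he₁ 0; have h11 := he₁ 1; have h20 := he₂ 0; have h21 := he₂ 1
  have h30 := he₃ 0; have h31 := he₃ 1; have h40 := he₄ 0; have h41 := he₄ 1
  simp only [Out₁, Out₂, Out₃, Out₄] at h
  rcases h with ((⟨a1, a2, a3, a4⟩ | ⟨a1, a2, a3, a4, a5⟩) | (⟨a1, a2, a3, a4⟩ | ⟨a1, a2, a3, a4, a5⟩)) |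
    ((⟨a1, a2, a3, a4⟩ | ⟨a1, a2, a3, a4, a5⟩) | (⟨a1, a2, a3, a4⟩ | ⟨a1, a2, a3, a4, a5⟩)) <;> omega

end Zhang

open Zhang

/-- **Zhang's crossing obstruction** (the planar fact in Georgii–Higuchi 2000, proof of Lemma 3.1,
Step 2, p. 8: paths to infinity of alternating colours from the four quadrant parts of `∂Λ` are
incompatible with both colours having a unique infinite cluster). Let `P` be a lattice walk inside
`Λ_N = [-N, N]²` from a vertex of `∂₁Λ_N = ∂Λ_N ∩ {x ≥ 0, y ≥ 0}` to a vertex of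
`∂₃Λ_N = ∂Λ_N ∩ {x ≤ 0, y ≤ 0}`, and `Q` a lattice walk inside `Λ_N` from `∂₂Λ_N` (`x ≤ 0 ≤ y`) to
`∂₄Λ_N` (`y ≤ 0 ≤ x`). Then `P` and `Q` have a common vertex. [cite: GeorgiiHiguchi2000, Lemma 3.1 (proof, Step 2, p. 8)] -/
theorem exists_mem_support_of_quadrant_crossing {N : ℕ} {e₁ e₂ e₃ e₄ : Site 2}
    (P : (zdGraph 2).Walk e₁ e₃) (Q : (zdGraph 2).Walk e₂ e₄)
    (hP : ∀ z ∈ P.support, ∀ i, -(N : ℤ) ≤ z i ∧ z i ≤ N)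
    (hQ : ∀ z ∈ Q.support, ∀ i, -(N : ℤ) ≤ z i ∧ z i ≤ N)
    (h₁ : (e₁ 0 = N ∧ 0 ≤ e₁ 1) ∨ (e₁ 1 = N ∧ 0 ≤ e₁ 0))
    (h₂ : (e₂ 1 = N ∧ e₂ 0 ≤ 0) ∨ (e₂ 0 = -N ∧ 0 ≤ e₂ 1))
    (h₃ : (e₃ 0 = -N ∧ e₃ 1 ≤ 0) ∨ (e₃ 1 = -N ∧ e₃ 0 ≤ 0))
    (h₄ : (e₄ 1 = -N ∧ 0 ≤ e₄ 0) ∨ (e₄ 0 = N ∧ e₄ 1 ≤ 0)) :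
    ∃ z ∈ P.support, z ∈ Q.support := by
  have he₁ := hP e₁ (Walk.start_mem_support P)
  have he₃ := hP e₃ (Walk.end_mem_support P)
  have he₂ := hQ e₂ (Walk.start_mem_support Q)
  have he₄ := hQ e₄ (Walk.end_mem_support Q)
  -- the four extensions
  obtain ⟨r₁, R₁, hr₁, hR₁⟩ := exists_ext₁ (N := N) (e₁ := e₁)
    (h₁.imp id fun h => ⟨h.1, h.2, (he₁ 0).2⟩)
  obtain ⟨r₂, R₂, hr₂, hR₂⟩ := exists_ext₂ (N := N) (e₂ := e₂)
    (h₂.imp id fun h => ⟨h.1, h.2, (he₂ 1).2⟩)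
  obtain ⟨r₃, R₃, hr₃, hR₃⟩ := exists_ext₃ (N := N) (e₃ := e₃)
    (h₃.imp id fun h => ⟨h.1, h.2, (he₃ 0).1⟩)
  obtain ⟨r₄, R₄, hr₄, hR₄⟩ := exists_ext₄ (N := N) (e₄ := e₄)
    (h₄.imp id fun h => ⟨h.1, h.2, (he₄ 1).1⟩)
  -- the extended crossings of `Λ_{N+1}`: left–right and bottom–top
  set P' : (zdGraph 2).Walk r₃ r₁ := (R₃.reverse.append P.reverse).append R₁ with hP'
  set Q' : (zdGraph 2).Walk r₄ r₂ := (R₄.reverse.append Q.reverse).append R₂ with hQ'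
  have hP'supp : ∀ z ∈ P'.support, z ∈ P.support ∨ (Out₁ N e₁ z ∨ Out₃ N e₃ z) := by
    intro z hz
    rw [hP', Walk.mem_support_append_iff, Walk.mem_support_append_iff, Walk.support_reverse,
      List.mem_reverse, Walk.support_reverse, List.mem_reverse] at hz
    rcases hz with (hz | hz) | hz
    · rcases hR₃ z hz with rfl | h
      · exact Or.inl (Walk.end_mem_support P)
      · exact Or.inr (Or.inr h)
    · exact Or.inl hz
    · rcases hR₁ z hz with rfl | h
      · exact Or.inl (Walk.start_mem_support P)
      · exact Or.inr (Or.inl h)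
  have hQ'supp : ∀ z ∈ Q'.support, z ∈ Q.support ∨ (Out₂ N e₂ z ∨ Out₄ N e₄ z) := by
    intro z hz
    rw [hQ', Walk.mem_support_append_iff, Walk.mem_support_append_iff, Walk.support_reverse,
      List.mem_reverse, Walk.support_reverse, List.mem_reverse] at hz
    rcases hz with (hz | hz) | hz
    · rcases hR₄ z hz with rfl | h
      · exact Or.inl (Walk.end_mem_support Q)
      · exact Or.inr (Or.inr h)
    · exact Or.inl hz
    · rcases hR₂ z hz with rfl | h
      · exact Or.inl (Walk.start_mem_support Q)
      · exact Or.inr (Or.inl h)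
  have hbox : ∀ z, (z ∈ P.support ∨ (Out₁ N e₁ z ∨ Out₃ N e₃ z)) ∨
      (z ∈ Q.support ∨ (Out₂ N e₂ z ∨ Out₄ N e₄ z)) →
      -((N : ℤ) + 1) ≤ z 0 ∧ z 0 ≤ N + 1 ∧ -((N : ℤ) + 1) ≤ z 1 ∧ z 1 ≤ N + 1 := by
    rintro z ((hz | hz) | (hz | hz))
    · have h0 := hP z hz 0; have h1 := hP z hz 1; omega
    · exact bounds_of_out he₁ he₂ he₃ he₄ (Or.inl hz)
    · have h0 := hQ z hz 0; have h1 := hQ z hz 1; omega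
    · exact bounds_of_out he₁ he₂ he₃ he₄ (Or.inr hz)
  obtain ⟨z, hzP', hzQ'⟩ := exists_mem_support_of_crossing (L := -((N : ℤ) + 1)) (R := N + 1)
    (B := -((N : ℤ) + 1)) (T := N + 1) P' Q' (fun z hz => hbox z (Or.inl (hP'supp z hz)))
    (fun z hz => hbox z (Or.inr (hQ'supp z hz))) hr₃ hr₁ hr₄ hr₂
  -- locate the common vertex
  rcases hP'supp z hzP' with hzP | hzodd <;> rcases hQ'supp z hzQ' with hzQ | hzeven
  · exact ⟨z, hzP, hzQ⟩
  · exact absurd hzeven (not_out_of_mem_box (e₁ := e₁) (e₂ := e₂) (e₃ := e₃) (e₄ := e₄) (hP z hzP)).2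
  · exact absurd hzodd (not_out_of_mem_box (e₁ := e₁) (e₂ := e₂) (e₃ := e₃) (e₄ := e₄) (hQ z hzQ)).1
  · rcases eq_of_out_odd_even he₁ he₂ he₃ he₄ hzodd hzeven with (h | h) | (h | h)
    · exact ⟨e₁, Walk.start_mem_support P, h ▸ Walk.start_mem_support Q⟩
    · exact ⟨e₁, Walk.start_mem_support P, h ▸ Walk.end_mem_support Q⟩
    · exact ⟨e₃, Walk.end_mem_support P, h ▸ Walk.start_mem_support Q⟩
    · exact ⟨e₃, Walk.end_mem_support P, h ▸ Walk.end_mem_support Q⟩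

end Literature.Probability.LatticeModels
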